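import Mathlib
import Summits.NavierStokesRegularity.NavierStokesRegularity.Theorems.EulerZoomLiouvillePowerGaugeEulerLiouvilleSelfSimilarTopBadNodeGraph
import Summits.NavierStokesRegularity.NavierStokesRegularity.Theorems.EulerZoomLiouvillePowerGaugeEulerLiouvilleSelfSimilarFiniteHyperbolicFarField
import HarnessLib.Audit

/-!
# Rung C1 of the crux `EulerZoomLiouville.PowerGaugeEulerLiouville`: THE CLASSICAL C1 THEOREM
# `0 < γ < ½`, `C²` self-similar Euler profile, far field (3.8) ⇒ `U ≡ 0` — no hypothesis on the nodal set

Route №10 `EulerZoomLiouville` (NavierStokesRegularity), crux E = stmt-NavierStokesRegularity-19832,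
tenure rung C1 (exactly self-similar members), registered residue `stub_selfSimilarExtremal`.
Thirty-second and FINAL file of the NODAL-CONTINUUM line (lineage ns-typeII-p1, gen 7).

* `ker_eq_line_of_badNode` — at a bad non-vortical node with a unit kernel vector `e` of `A = DV(z)`, `ker A = ℝe`
  (`kernel_coord_eq_zero_of_top`: `tr A = 3γ < 1 + γ ≤` top eigenvalue).
* `eq_zero_of_farField` — **CIV 2026, the exactly self-similar member of the crux in the classical class, fully**:
  a `C²` profile `(U, P)` of (3.3) with `0 < γ < ½` and the far-field condition (3.8) is trivial.  Proof:
  `U ≢ 0` ⇒ a degenerate top bad node (`exists_degenerate_topBadNode_of_ne_zero`) ⇒ unit kernel vector, `ker = ℝe` ⇒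
  kernel-graph data (`exists_kernelGraph_data`) ⇒ `false_of_topBadNode_of_graph` (the no-exit lemma + the cone
  lemma).  Twenty-odd files of local analysis at the top bad node replace every nodal hypothesis of
  [CIV 2026, §3.5 Thms 3.8–3.10] (finite / hyperbolic / countable stagnation set).
* `eq_zero_of_farField_of_exponent`, `selfSimilar_ae_eq_zero_of_farField` — the route's exponent form
  `γ = 1/(2+ρ)` and the MEMBER-LEVEL statement (binder shape of the strata of `stub_selfSimilarExtremalRest`): an
  exactly self-similar field whose classical profile has (3.8) vanishes a.e. on `(−∞,0) × ℝ³`.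

WHAT THIS IS NOT: not NS, not E, not the stub `stub_selfSimilarExtremalRest` (whose binder is the WEAK / `C¹_loc`
class without (3.8)): this closes the CLASSICAL (`C²` + (3.8)) member completely; the weak class and profiles without
the far-field normalisation remain.  [cite: ConstantinIgnatovaVicol2026Putative, §3.4.3–§3.5, §4, Thms 3.8–3.10]
[cite: KatokHasselblatt1995, §6.2]
-/

noncomputable section

-- flat `Theorems/<Route><Decl>…` files of one crux share the namespace of the crux (tree convention)
set_option linter.dupNamespace false

open MeasureTheory Set Filter Topology Metric Function InnerProductSpace
open scoped RealInnerProductSpace NNReal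

namespace Summit.NavierStokesRegularity.NavierStokesRegularity.Theorems.PowerGaugeEulerLiouville.NodalContinuum

open Literature.Analysis Literature.Analysis.FluidPDE Literature.Analysis.ODE
open Summit.NavierStokesRegularity.NavierStokesRegularity.Theorems.PowerGaugeEulerLiouville.NodalFiniteness
open Summit.NavierStokesRegularity.NavierStokesRegularity.Theorems.PowerGaugeEulerLiouville.Kelvin

variable {γ C : ℝ} {c : EuclideanSpace ℝ (Fin 3)}
  {U : EuclideanSpace ℝ (Fin 3) → EuclideanSpace ℝ (Fin 3)} {P : EuclideanSpace ℝ (Fin 3) → ℝ}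

/-- **The kernel of `DV(z)` at a bad non-vortical node is the line through a unit kernel vector.**
[cite: ConstantinIgnatovaVicol2026Putative, §3.5 Thms 3.8–3.10 (linear algebra at a node; not in print)] -/
theorem ker_eq_line_of_badNode (h : IsSelfSimilarEulerProfile γ c U P) (hγ : 0 < γ) (hγ2 : γ < 1 / 2)
    {z : EuclideanSpace ℝ (Fin 3)} (hΩz : curl U z = 0)
    (hbad : ∃ w : EuclideanSpace ℝ (Fin 3), ‖w‖ = 1 ∧ 1 ≤ ⟪fderiv ℝ U z w, w⟫)
    {e : EuclideanSpace ℝ (Fin 3)} (he1 : ‖e‖ = 1) (hAe : fderiv ℝ (selfSimilarTransport γ c U) z e = 0) :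
    ∀ v, fderiv ℝ (selfSimilarTransport γ c U) z v = 0 → ⟪e, v⟫ = 0 → v = 0 := by
  classical
  set A : EuclideanSpace ℝ (Fin 3) →L[ℝ] EuclideanSpace ℝ (Fin 3) :=
    fderiv ℝ (selfSimilarTransport γ c U) z with hAdef
  have hDV : A = γ • ContinuousLinearMap.id ℝ _ + fderiv ℝ U z := fderiv_transport_eq h z
  have hA : (A : EuclideanSpace ℝ (Fin 3) →ₗ[ℝ] EuclideanSpace ℝ (Fin 3)).IsSymmetric :=
    isSymmetric_fderiv_transport_of_curl_eq_zero h hΩz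
  have hAe' : A e = 0 := hAe
  have hn : Module.finrank ℝ (EuclideanSpace ℝ (Fin 3)) = 3 := by simp
  set b := hA.eigenvectorBasis hn with hbdef
  set a : Fin 3 → ℝ := hA.eigenvalues hn with hadef
  have hb : ∀ i, A (b i) = a i • b i := fun i => hA.apply_eigenvectorBasis hn i
  have hsum : ∑ i, a i < 1 + γ := by
    have htr := hA.trace_eq_sum_eigenvalues hn
    have hdiv : LinearMap.trace ℝ _ (fderiv ℝ U z :
        EuclideanSpace ℝ (Fin 3) →ₗ[ℝ] EuclideanSpace ℝ (Fin 3)) = 0 := h.divFree z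
    have h3 : LinearMap.trace ℝ _ (A : EuclideanSpace ℝ (Fin 3) →ₗ[ℝ] EuclideanSpace ℝ (Fin 3)) =
        3 * γ := by
      rw [hDV, ContinuousLinearMap.toLinearMap_add, ContinuousLinearMap.toLinearMap_smul, map_add,
        map_smul, hdiv, ContinuousLinearMap.coe_id, LinearMap.trace_id, finrank_euclideanSpace,
        Fintype.card_fin]
      norm_num
      ring
    have : ∑ i, a i = 3 * γ := by
      rw [← h3, htr]
      simp [hadef]
    rw [this]; linarith only [hγ2]
  obtain ⟨w, hw1, hw⟩ := hbad
  have hAw : 1 + γ ≤ ⟪A w, w⟫ := by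
    rw [hDV]
    simp only [add_apply, FunLike.coe_smul, Pi.smul_apply, ContinuousLinearMap.id_apply,
      inner_add_left, real_inner_smul_left, real_inner_self_eq_norm_sq, hw1]
    linarith only [hw]
  obtain ⟨i₀, hi₀, huniq, hker⟩ := kernel_coord_eq_zero_of_top hA b hb (by linarith : (0 : ℝ) < 1 + γ)
    hsum ⟨w, hw1, hAw⟩ he1 hAe'
  intro v hv hev
  have hv' : A v = 0 := hv
  have hcoord : ∀ i, ⟪b i, v⟫ = 0 := by
    intro i
    by_cases hi : i = i₀
    · rw [hi]; exact hker v hev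
    · have h1 := inner_basis_apply_of_isSymmetric hA b hb v i
      rw [hv', inner_zero_right] at h1
      exact (mul_eq_zero.1 h1.symm).resolve_left (huniq i hi)
  rw [← b.sum_repr' v]
  simp [hcoord]

/-- **The classical C1 theorem: a `C²` self-similar Euler profile with `0 < γ < ½` and the far field (3.8) vanishes.**
[cite: ConstantinIgnatovaVicol2026Putative, §3.5 Thms 3.8–3.10 (all nodal hypotheses removed; local analysis at the top bad node, not in print)] -/
theorem eq_zero_of_farField (h : IsSelfSimilarEulerProfile γ c U P) (hγ : 0 < γ) (hγ2 : γ < 1 / 2)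
    (hfar : HasSelfSimilarFarFieldWith γ c C U) : U = 0 := by
  by_contra hU
  obtain ⟨z, hz, hΩz, hbad, hcl, hconf, v, hv0, hv⟩ := exists_degenerate_topBadNode_of_ne_zero h hγ hγ2 hfar hU
  set e : EuclideanSpace ℝ (Fin 3) := ‖v‖⁻¹ • v with he
  have he1 : ‖e‖ = 1 := norm_smul_inv_norm hv0
  have hAe : fderiv ℝ (selfSimilarTransport γ c U) z e = 0 := by
    rw [fderiv_transport_eq h z, he, map_smul]
    simp only [add_apply, FunLike.coe_smul, Pi.smul_apply, ContinuousLinearMap.id_apply, hv]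
    rw [← add_smul]; simp
  have hker := ker_eq_line_of_badNode h hγ hγ2 hΩz hbad he1 hAe
  obtain ⟨δ, L, C₁, g, g', φ, hδ, hL, hC₁, hg0, hge, hgd, hg', hpar, hφc, hφsq, hφlip⟩ :=
    exists_kernelGraph_data h hz hΩz he1 hAe hker
  exact false_of_topBadNode_of_graph h hγ hγ2 hfar hz hΩz hbad hcl hconf he1 hAe hδ hL hC₁ hg0 hge hgd hg'
    hpar hφc hφsq hφlip

/-- **Exponent form** (route EulerZoomLiouville: `γ = 1/(2+ρ)`, window `ρ > 0`).
[cite: ConstantinIgnatovaVicol2026Putative, §3.5 Thms 3.8–3.10 (nodal hypotheses removed)] -/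
theorem eq_zero_of_farField_of_exponent {ρ : ℝ} (hρ : 0 < ρ)
    (h : IsSelfSimilarEulerProfile (1 / (2 + ρ)) c U P) (hfar : HasSelfSimilarFarFieldWith (1 / (2 + ρ)) c C U) :
    U = 0 := by
  have hγ : 0 < 1 / (2 + ρ) := by positivity
  have hγ2 : 1 / (2 + ρ) < 1 / 2 := by
    rw [div_lt_div_iff₀ (by positivity) (by positivity)]; linarith
  exact eq_zero_of_farField h hγ hγ2 hfar

/-- **MEMBER-LEVEL statement** (binder shape of the strata of `stub_selfSimilarExtremalRest`,
`u(τ) = selfSimilarCollapse (1/(2+ρ)) 0 V τ`, any `ρ > 0`): an exactly self-similar field whose classical (`C²`)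
profile has the far field (3.8) vanishes a.e. on `(−∞,0) × ℝ³` — unconditionally, with NO hypothesis on the stagnation
set. [cite: ConstantinIgnatovaVicol2026Putative, §3.5 Thm 3.10 (nodal hypotheses removed; not in print)] -/
theorem selfSimilar_ae_eq_zero_of_farField {ρ : ℝ} (hρ : 0 < ρ)
    {V : EuclideanSpace ℝ (Fin 3) → EuclideanSpace ℝ (Fin 3)} {P : EuclideanSpace ℝ (Fin 3) → ℝ}
    (u : ℝ → EuclideanSpace ℝ (Fin 3) → EuclideanSpace ℝ (Fin 3))
    (hu : ∀ τ : ℝ, τ < 0 → u τ = selfSimilarCollapse (1 / (2 + ρ)) 0 V τ)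
    (hprof : IsSelfSimilarEulerProfile (1 / (2 + ρ)) 0 V P)
    (hfar : HasSelfSimilarFarField (1 / (2 + ρ)) 0 V) :
    uncurry u =ᵐ[volume.restrict (Iio (0 : ℝ) ×ˢ (univ : Set (EuclideanSpace ℝ (Fin 3))))] 0 := by
  obtain ⟨C, hC⟩ := hfar
  exact selfSimilar_ae_eq_zero_of_profile_eq_zero u hu (eq_zero_of_farField_of_exponent hρ hprof hC)

end Summit.NavierStokesRegularity.NavierStokesRegularity.Theorems.PowerGaugeEulerLiouville.NodalContinuum
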